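import Literature.MathematicalPhysics.QuantumFieldTheory.FiniteGaugeGroupTorus
import Literature.MathematicalPhysics.QuantumFieldTheory.Z2WilsonLoopGKS
import HarnessLib

/-!
# `ℤ₂` lattice gauge theory on the torus: high- and low-temperature expansions of the partition function

Support file for the Kramers–Wannier / Wegner self-duality of four-dimensional `ℤ₂` lattice gauge
theory (`…Theses.ModularSelfDualFold.Z2TorusFreeEnergySelfDuality`). For the gauge group
`ℤ₂ = Multiplicative (ZMod 2)` with the sign representation `z2Rep` (Wilson action
`S(U) = ∑ₚ (1 - σ_p)`, `σ_p = ±1` the plaquette variable) on the torus `(ℤ/Mℤ)^d`, `M ≥ 2`: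

* `partitionFunction_toReal_eq` (any finite gauge group): `Z = |G|^{-#edges} ∑_U e^{-β S(U)}`.
* `wilsonAction_z2_eq_two_mul_card`: `S(U) = 2 · #{frustrated plaquettes}`.
* **Low-temperature form** `sum_exp_dual_eq`: at the dual coupling `β* = -½ log t`,
  `∑_U e^{-β* S(U)} = ∑_U t^{#frustrated(U)} = K · ∑_{η exact} t^{#supp η}`, the last sum over the
  exact plaquette fields `η = plaqField U` (tree `sum_comp_plaqField`), `K = #{U flat}`.
* **High-temperature (character) expansion** `sum_exp_eq_highTemp`:
  `∑_U e^{-β S(U)} = (e^{-β} cosh β)^{#plaq} · 2^{#edges} · ∑_{S even} (tanh β)^{#S}`, the sum over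
  the plaquette sets `S` with even incidence at every edge (`evenSets`; the closed surfaces of the
  high-temperature expansion), from `e^{-β(1-σ)} = e^{-β} cosh β (1 + σ tanh β)`,
  `∏ₚ (1 + t σ_p) = ∑_S t^{#S} ∏_{p ∈ S} σ_p` and the character orthogonality
  `∑_U ∏_{p∈S} σ_p = 2^{#edges} · [S even]`.

Everything here is proved; finite sums only (Wegner, J. Math. Phys. 12 (1971) 2259, §III;
Balian–Drouffe–Itzykson, Phys. Rev. D 11 (1975) 2098, §III).
-/

noncomputable section

namespace Summit.QuantumFields.YangMills.Theorems.Z2SelfDuality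

open Finset MeasureTheory
open scoped ENNReal
open Literature.MathematicalPhysics.QuantumLattice (z2Rep)
open Literature.MathematicalPhysics.QuantumFieldTheory

/-! ### Finite gauge groups: the partition function is a finite sum -/

section FiniteGroup

variable {d L N : ℕ} {G : Type*} [Group G] [Fintype G] [TopologicalSpace G] [DiscreteTopology G]
  [IsTopologicalGroup G] [MeasurableSpace G] [BorelSpace G]

/-- **Over a finite gauge group the torus partition function is a finite sum**:
`Z = |G|^{-#edges} · ∑_U e^{-β S(U)}` (the product Haar measure is the uniform probability on
configurations). [cite: SeilerLNP1982, Ch. 1 (finite-volume lattice gauge theory: the Gibbs measure)] -/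
theorem partitionFunction_toReal_eq [NeZero L] (ρ : G →* Matrix (Fin N) (Fin N) ℂ) (β : ℝ) :
    (partitionFunction (d := d) (L := L) ρ β).toReal =
      ((Fintype.card G : ℝ)⁻¹) ^ Fintype.card (Edge d L) *
        ∑ V : GaugeConfig d L G, Real.exp (-β * wilsonAction ρ V) := by
  classical
  haveI : DiscreteMeasurableSpace G := discreteMeasurableSpace_of_borel
  set c : ℝ≥0∞ := (((Fintype.card G : ℝ≥0∞))⁻¹) ^ Fintype.card (Edge d L) with hc
  have hcU : ∀ V : GaugeConfig d L G, (Measure.pi fun _ : Edge d L => haarProbability G) {V} = c :=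
    fun V => pi_haarProbability_singleton V
  have hZ : partitionFunction (d := d) (L := L) ρ β =
      (∑ V : GaugeConfig d L G, ENNReal.ofReal (Real.exp (-β * wilsonAction ρ V))) * c := by
    rw [partitionFunction, wilsonWeight, withDensity_apply _ MeasurableSet.univ,
      Measure.restrict_univ, lintegral_fintype, Finset.sum_mul]
    simp only [hcU]
  rw [hZ, ENNReal.toReal_mul, ENNReal.toReal_sum fun V _ => ENNReal.ofReal_ne_top, mul_comm]
  congr 1
  · rw [hc, ENNReal.toReal_pow, ENNReal.toReal_inv, ENNReal.toReal_natCast]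
  · exact Finset.sum_congr rfl fun V _ => ENNReal.toReal_ofReal (Real.exp_nonneg _)

end FiniteGroup

/-! ### The `ℤ₂` Wilson action counts frustrated plaquettes -/

section Z2

variable {d M : ℕ} [NeZero M]

/-- Notation-free abbreviation for the gauge group `ℤ₂`. [folklore] -/
abbrev Z2 : Type := Multiplicative (ZMod 2)

/-- An element of `ℤ₂` is `1` or the generator. [folklore] -/
theorem z2_eq_one_or (g : Z2) : g = 1 ∨ g = Multiplicative.ofAdd 1 := by
  by_cases h : g = 1
  · exact Or.inl h
  · exact Or.inr (z2_eq_ofAdd_one_of_ne_one h)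

/-- The character of `ℤ₂`: `χ(g) = 1` if `g = 1`, `-1` otherwise. [folklore] -/
theorem z2Character_eq_ite (g : Z2) : z2Character g = if g = 1 then 1 else -1 := by
  rcases z2_eq_one_or g with rfl | rfl
  · simp
  · rw [if_neg (by decide)]; exact z2Character_ofAdd_one

/-- The finite set `ℤ₂ = {1, g}`. [folklore] -/
theorem univ_z2 : (Finset.univ : Finset Z2) = {1, Multiplicative.ofAdd 1} := by decide

/-- The **frustrated plaquettes** of a `ℤ₂` configuration: those with plaquette variable `-1`. [folklore] -/
def frustrated (U : GaugeConfig d M Z2) : Finset (Plaquette d M) :=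
  Finset.univ.filter fun p => plaquetteHolonomy U p.1 p.2.1.1 p.2.1.2 ≠ 1

/-- **The `ℤ₂` Wilson action is twice the number of frustrated plaquettes**,
`S(U) = ∑ₚ (1 - σ_p) = 2 · #{p : σ_p = -1}`. [cite: arXiv181109770, §1.1 (1.2)] -/
theorem wilsonAction_z2_eq_two_mul_card (U : GaugeConfig d M Z2) :
    wilsonAction z2Rep U = 2 * ((frustrated U).card : ℝ) := by
  classical
  unfold wilsonAction frustrated
  have hterm : ∀ p : Plaquette d M,
      ((1 : ℕ) : ℝ) - (z2Rep (plaquetteHolonomy U p.1 p.2.1.1 p.2.1.2)).trace.re =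
        2 * (if plaquetteHolonomy U p.1 p.2.1.1 p.2.1.2 ≠ 1 then (1 : ℝ) else 0) := by
    intro p
    rw [← z2Character_eq_trace_re, z2Character_eq_ite]
    by_cases h1 : plaquetteHolonomy U p.1 p.2.1.1 p.2.1.2 = 1
    · simp [h1]
    · rw [if_neg h1, if_pos h1]; norm_num
  rw [Finset.sum_congr rfl fun p _ => hterm p, ← Finset.mul_sum, Finset.sum_boole]

/-- Frustration read through the additive plaquette field: `σ_p = -1 ↔ plaqField U p ≠ 0`. [folklore] -/
theorem frustrated_eq_filter_plaqField (U : GaugeConfig d M Z2) :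
    frustrated U = Finset.univ.filter fun p => plaqField U p ≠ 0 := by
  unfold frustrated
  congr 1
  funext p
  rw [plaqField_apply]
  simp

/-! ### Low-temperature form: `∑_U t^{#frustrated}` and exact plaquette fields -/

/-- The weight `t^{#supp η}` of a function of the plaquettes. [folklore] -/
def suppWeight (t : ℝ) (η : Plaquette d M → Additive Z2) : ℝ :=
  t ^ (Finset.univ.filter fun p => η p ≠ 0).card

/-- The number `K = #{U : plaqField U = 0}` of flat `ℤ₂` configurations of the torus. [folklore] -/
def flatCount (d M : ℕ) [NeZero M] : ℕ :=
  (Finset.univ.filter fun U : GaugeConfig d M Z2 => plaqField U = 0).card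

/-- The **low-temperature sum** `B(t) = ∑_{η exact} t^{#supp η}` over the exact plaquette fields
(the image of `U ↦ plaqField U`). [folklore] -/
def exactSum (d M : ℕ) [NeZero M] (t : ℝ) : ℝ :=
  ∑ η ∈ Finset.univ.image (plaqField (d := d) (L := M) (G := Z2)), suppWeight t η

/-- **At the dual coupling the Boltzmann weight counts frustrated plaquettes**:
`e^{-β* S(U)} = t^{#frustrated(U)}` for `β* = -(log t)/2`, `t > 0`. [cite: SeilerLNP1982, Ch. 1] -/
theorem exp_dual_mul_wilsonAction {t : ℝ} (ht : 0 < t) (U : GaugeConfig d M Z2) :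
    Real.exp (-(-(Real.log t) / 2) * wilsonAction z2Rep U) = t ^ (frustrated U).card := by
  rw [wilsonAction_z2_eq_two_mul_card]
  have : -(-(Real.log t) / 2) * (2 * ((frustrated U).card : ℝ)) = (frustrated U).card * Real.log t := by
    ring
  rw [this, Real.exp_nat_mul, Real.exp_log ht]

/-- **Low-temperature form of the `ℤ₂` torus sum**: `∑_U e^{-β* S(U)} = K · B(t)` with
`β* = -(log t)/2`, `K` the number of flat configurations and `B(t)` the sum of `t^{#supp}` over
exact plaquette fields (every exact field has exactly `K` preimages). [cite: SeilerLNP1982, Ch. 1] -/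
theorem sum_exp_dual_eq {t : ℝ} (ht : 0 < t) :
    ∑ U : GaugeConfig d M Z2, Real.exp (-(-(Real.log t) / 2) * wilsonAction z2Rep U) =
      (flatCount d M : ℝ) * exactSum d M t := by
  classical
  simp only [exp_dual_mul_wilsonAction ht, frustrated_eq_filter_plaqField]
  have h := sum_comp_plaqField (d := d) (L := M) (G := Z2) (M := ℝ) (fun η => suppWeight t η)
  simp only [suppWeight] at h
  rw [h, nsmul_eq_mul]
  rfl

/-! ### High-temperature (character) expansion -/

/-- **The elementary identity behind the high-temperature expansion**:
`e^{-β(1 - χ(g))} = e^{-β} cosh β · (1 + tanh β · χ(g))` for `χ(g) = ±1`. [folklore] -/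
theorem exp_neg_mul_one_sub_z2Character (β : ℝ) (g : Z2) :
    Real.exp (-β * (1 - z2Character g)) =
      Real.exp (-β) * Real.cosh β * (1 + Real.tanh β * z2Character g) := by
  have hcosh : Real.cosh β ≠ 0 := (Real.cosh_pos β).ne'
  rw [z2Character_eq_ite]
  split_ifs with h
  · have h1 : Real.exp (-β) * Real.cosh β * (1 + Real.tanh β * 1) =
        Real.exp (-β) * (Real.cosh β + Real.sinh β) := by
      rw [Real.tanh_eq_sinh_div_cosh]; field_simp
    rw [h1, Real.cosh_add_sinh, ← Real.exp_add]
    norm_num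
  · have h1 : Real.exp (-β) * Real.cosh β * (1 + Real.tanh β * (-1)) =
        Real.exp (-β) * (Real.cosh β - Real.sinh β) := by
      rw [Real.tanh_eq_sinh_div_cosh]; field_simp; ring
    rw [h1, Real.cosh_sub_sinh, ← Real.exp_add]
    congr 1; ring

/-- The `ℤ₂` Boltzmann weight as a product over plaquettes of `1 + t σ_p`:
`e^{-β S(U)} = (e^{-β} cosh β)^{#plaq} ∏ₚ (1 + tanh β · σ_p)`. [folklore] -/
theorem exp_neg_mul_wilsonAction_z2_eq_prod (β : ℝ) (U : GaugeConfig d M Z2) :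
    Real.exp (-β * wilsonAction z2Rep U) =
      (Real.exp (-β) * Real.cosh β) ^ Fintype.card (Plaquette d M) *
        ∏ p : Plaquette d M, (1 + Real.tanh β * z2Character (plaquetteHolonomy U p.1 p.2.1.1 p.2.1.2)) := by
  unfold wilsonAction
  rw [Finset.mul_sum, Real.exp_sum]
  simp only [Nat.cast_one, ← z2Character_eq_trace_re, exp_neg_mul_one_sub_z2Character]
  rw [Finset.prod_mul_distrib, Finset.prod_const, Finset.card_univ]

/-- The **incidence number** of the plaquette set `S` at the edge `e`: the number of plaquettes of
`S` having `e` among their four edges. [folklore] -/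
def inc (S : Finset (Plaquette d M)) (e : Edge d M) : ℕ :=
  (S.filter fun p => e ∈ torusPlaqEdges p).card

/-- The **even plaquette sets** (closed surfaces of the high-temperature expansion, `2`-cycles
mod `2`): every edge lies in an even number of their plaquettes. [folklore] -/
def evenSets (d M : ℕ) [NeZero M] : Finset (Finset (Plaquette d M)) :=
  (Finset.univ : Finset (Plaquette d M)).powerset.filter fun S => ∀ e : Edge d M, Even (inc S e)

/-- Membership in `evenSets`. [folklore] -/
theorem mem_evenSets {S : Finset (Plaquette d M)} : S ∈ evenSets d M ↔ ∀ e : Edge d M, Even (inc S e) := by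
  simp [evenSets]

/-- The plaquette character is the product of the four edge characters (as a product over the
finite set of edges, `M ≥ 2`). [cite: arXiv181109770, §1.1 (1.1)] -/
theorem z2Character_plaquetteHolonomy_eq_prod [Fact (1 < M)] (U : GaugeConfig d M Z2)
    (p : Plaquette d M) :
    z2Character (plaquetteHolonomy U p.1 p.2.1.1 p.2.1.2) = ∏ e ∈ torusPlaqEdges p, z2Character (U e) := by
  rw [← spinProduct_torusPlaqEdges U p]
  simp [Literature.Probability.LatticeModels.spinProduct]

/-- **A product of plaquette characters is a product of edge characters with the incidence
numbers as exponents**: `∏_{p ∈ S} σ_p = ∏ₑ χ(U_e)^{inc S e}`. [folklore] -/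
theorem prod_z2Character_eq_prod_pow [Fact (1 < M)] (U : GaugeConfig d M Z2)
    (S : Finset (Plaquette d M)) :
    ∏ p ∈ S, z2Character (plaquetteHolonomy U p.1 p.2.1.1 p.2.1.2) =
      ∏ e : Edge d M, z2Character (U e) ^ inc S e := by
  classical
  simp only [z2Character_plaquetteHolonomy_eq_prod]
  have h1 : ∀ p ∈ S, ∏ e ∈ torusPlaqEdges p, z2Character (U e) =
      ∏ e : Edge d M, if e ∈ torusPlaqEdges p then z2Character (U e) else 1 := by
    intro p _
    rw [Finset.prod_ite_mem, Finset.univ_inter]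
  rw [Finset.prod_congr rfl h1, Finset.prod_comm]
  refine Finset.prod_congr rfl fun e _ => ?_
  rw [Finset.prod_ite, Finset.prod_const_one, mul_one, Finset.prod_const]
  rfl

/-- **Character orthogonality on `ℤ₂`**: `∑_g χ(g)^m = 2` if `m` is even, `0` if `m` is odd. [folklore] -/
theorem sum_z2Character_pow (m : ℕ) :
    ∑ g : Z2, z2Character g ^ m = if Even m then 2 else 0 := by
  rw [univ_z2, Finset.sum_pair (by decide)]
  simp only [z2Character_one, one_pow, z2Character_ofAdd_one]
  split_ifs with h
  · rw [h.neg_one_pow]; norm_num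
  · rw [(Nat.not_even_iff_odd.1 h).neg_one_pow]; norm_num

/-- **The configuration sum of a product of plaquette characters**:
`∑_U ∏_{p ∈ S} σ_p = 2^{#edges}` if `S` is even and `0` otherwise. [cite: SeilerLNP1982, Ch. 1 (character expansion)] -/
theorem sum_prod_z2Character [Fact (1 < M)] (S : Finset (Plaquette d M)) :
    ∑ U : GaugeConfig d M Z2, ∏ p ∈ S, z2Character (plaquetteHolonomy U p.1 p.2.1.1 p.2.1.2) =
      if S ∈ evenSets d M then (2 : ℝ) ^ Fintype.card (Edge d M) else 0 := by
  classical
  simp only [prod_z2Character_eq_prod_pow]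
  -- `∑_U ∏ₑ f e (U e) = ∏ₑ ∑_g f e g`
  have h := Finset.prod_univ_sum (fun _ : Edge d M => (Finset.univ : Finset Z2))
    (fun e g => z2Character g ^ inc S e)
  rw [Fintype.piFinset_univ] at h
  rw [← h]
  simp only [sum_z2Character_pow]
  by_cases hS : ∀ e : Edge d M, Even (inc S e)
  · rw [if_pos (mem_evenSets.2 hS), Finset.prod_congr rfl fun e _ => if_pos (hS e), Finset.prod_const,
      Finset.card_univ]
  · rw [if_neg (fun h' => hS (mem_evenSets.1 h'))]
    obtain ⟨e, he⟩ := not_forall.1 hS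
    exact Finset.prod_eq_zero (Finset.mem_univ e) (if_neg he)

/-- The **high-temperature sum** `A₀(t) = ∑_{S even} t^{#S}` over the even plaquette sets of the
torus (closed surfaces). [folklore] -/
def evenSum (d M : ℕ) [NeZero M] (t : ℝ) : ℝ :=
  ∑ S ∈ evenSets d M, t ^ S.card

/-- **High-temperature expansion of the `ℤ₂` torus sum** (`M ≥ 2`):
`∑_U e^{-β S(U)} = (e^{-β} cosh β)^{#plaq} · 2^{#edges} · ∑_{S even} (tanh β)^{#S}`. [cite: SeilerLNP1982, Ch. 1 (character expansion)] -/
theorem sum_exp_eq_highTemp [Fact (1 < M)] (β : ℝ) :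
    ∑ U : GaugeConfig d M Z2, Real.exp (-β * wilsonAction z2Rep U) =
      (Real.exp (-β) * Real.cosh β) ^ Fintype.card (Plaquette d M) *
        ((2 : ℝ) ^ Fintype.card (Edge d M) * evenSum d M (Real.tanh β)) := by
  classical
  simp only [exp_neg_mul_wilsonAction_z2_eq_prod, ← Finset.mul_sum]
  congr 1
  -- expand the product over plaquettes
  have hexp : ∀ U : GaugeConfig d M Z2,
      ∏ p : Plaquette d M, (1 + Real.tanh β * z2Character (plaquetteHolonomy U p.1 p.2.1.1 p.2.1.2)) =
        ∑ S ∈ (Finset.univ : Finset (Plaquette d M)).powerset,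
          Real.tanh β ^ S.card * ∏ p ∈ S, z2Character (plaquetteHolonomy U p.1 p.2.1.1 p.2.1.2) := by
    intro U
    rw [Finset.prod_one_add]
    refine Finset.sum_congr rfl fun S _ => ?_
    rw [Finset.prod_mul_distrib, Finset.prod_const]
  simp only [hexp]
  rw [Finset.sum_comm]
  simp only [← Finset.mul_sum, sum_prod_z2Character, mul_ite, mul_zero]
  rw [Finset.sum_ite, Finset.sum_const_zero, add_zero, evenSum, Finset.mul_sum]
  have hset : (Finset.univ : Finset (Plaquette d M)).powerset.filter (fun S => S ∈ evenSets d M) =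
      evenSets d M := by
    ext S; simp [evenSets]
  rw [hset]
  refine Finset.sum_congr rfl fun S _ => ?_
  ring

end Z2

end Summit.QuantumFields.YangMills.Theorems.Z2SelfDuality
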